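import Literature.Computability.AlgebraicComplexity.BorderRankMatMulThreeKernel
import HarnessLib

/-!
# Borel-fixed candidates of `⟨3,3,3⟩`: the `(111)` test procedure (computation)

Topic `Literature/Computability/AlgebraicComplexity`. The last test of CHL's border apolarity for
`⟨3,3,3⟩`, `r = 16`: for each triple `(S₁, S₂, S₃)` of the eight surviving `(110)`-models
(`BorderRankMatMulThreeEnumData.lean`), placed in `A ⊗ B`, `B ⊗ C`, `A ⊗ C` through the
relabelings `σ₂`, `σ₃` of `BorderRankMatMulThreeTransportData.lean`, the `(111)`-test space
`(S₁ ⊗ C) ∩ (A ⊗ S₂) ∩ (S₃ ⊗ B) ≤ K^{A ⊗ B ⊗ C}` has dimension `≤ 15 < 16`. This file is the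
COMPUTATION (pure list code, evaluated by the kernel in `BorderRankMatMulThreeTripleRun*.lean`);
its soundness is `BorderRankMatMulThreeTripleSound.lean`.

A model `S` (dually: vanishing at the non-root off-diagonal positions, the relations `Ker.drels`
of each diagonal type) imposes on a 3-array `x ∈ K^{A ⊗ B ⊗ C}` (coordinates coded
`81a + 9b + c`) the vanishing of KILLED coordinates (`Ker.killed`, counted directly) and
RELATIONS among three coordinates (`Ker.Sel`, through the three slicings `x(·,·,c)`,
`x(a,·,·) ∘ σ₂`, `x(·,b,·) ∘ σ₃`). All these functionals are torus-weight vectors; the weights of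
the triple codes are `u + 7v + 49w` with `u, v, w ∈ {0,…,6}` the classes `Ker.cls` of the three
index pairs, so the relations are generated weight class by weight class (`Ker.genRows`) and a
greedy triangular family with non-killed pivots is selected in each class (`Ker.triSelect`,
untrusted). The CHECKER `Ker.certOK111` re-derives every selected functional from its descriptor,
checks it legitimate, homogeneous of the stated weight, with a non-killed pivot of non-zero
coefficient, the weights sorted, and triangularity inside each weight (`Ker.triFlat`) — so the
killed unit functionals and the selected relations are linearly independent and
`dim ≤ 729 - #killed - #selected =: Ker.bound111`.

## References

* A. Conner, A. Harper, J. M. Landsberg, *New lower bounds for matrix multiplication and `det₃`*,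
  Forum Math. Pi 11 (2023) e17, arXiv:1911.07981 — §3 (ii), §6. [ConnerHarperLandsberg2023]
-/

namespace Literature.Computability.AlgebraicComplexity

namespace BorderApolarity

namespace MatMul3

namespace Ker

/-! ## Profiles, killed coordinates, relations -/

/-- A sparse integer functional on triple codes `81a + 9b + c`. [folklore] -/
abbrev TFunc : Type := List (ℕ × ℤ)

/-- The block code `(roots, δ)` of block `jk` of a profile. [folklore] -/
def blockOf (p : List (List (ℕ × ℕ) × ℕ)) (jk : ℕ) : List (ℕ × ℕ) × ℕ := p.getD jk ([], 0)

/-- Relations satisfied by the diagonals of each diagonal type code (none for `free`/`all`).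
[cite: ConnerHarperLandsberg2023, §6] -/
def drels (t : ℕ) : List (List ℤ) :=
  if t = 0 then [[1, -1, 0], [0, 1, -1]] else if t = 1 then [[0, 1, -1]]
  else if t = 2 then [[1, -1, 0]] else if t = 3 then [[1, 1, -2]]
  else if t = 4 then [[-2, 1, 1]] else []

/-- The relations of block `jk` of a profile. [folklore] -/
def relsOf (p : List (List (ℕ × ℕ) × ℕ)) (jk : ℕ) : List (List ℤ) :=
  drels (dcode (blockOf p jk).1 (blockOf p jk).2)

/-- Is position `(i, i')` of block `jk` a non-root off-diagonal position (a vanishing coordinate of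
the model)? [folklore] -/
def offRoot (p : List (List (ℕ × ℕ) × ℕ)) (jk i i' : ℕ) : Bool :=
  decide (i ≠ i') && !((blockOf p jk).1.contains (i, i'))

/-- Table of `offRoot`, indexed `[jk][3i + i']`. [folklore] -/
def offTab (p : List (List (ℕ × ℕ) × ℕ)) : List (List Bool) :=
  (List.range 9).map fun jk => (List.range 9).map fun ii => offRoot p jk (ii / 3) (ii % 3)

/-- Lookup in an `offRoot` table. [folklore] -/
def offLook (tab : List (List Bool)) (jk ii : ℕ) : Bool := (tab.getD jk []).getD ii false

/-- **Killed triple coordinates** (from the three `offRoot` tables): `x(a,b,c) = 0` is forced by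
`S₁` (pair `(a,b)`: block `(b.2, a.2)`, position `(a.1, b.1)`), by `S₂` through `σ₂` (block
`(rev c.2, rev b.1)`, position `(b.2, c.1)`) or by `S₃` through `σ₃` (block `(rev c.1, a.1)`,
position `(a.2, c.2)`). [cite: ConnerHarperLandsberg2023, §3 (ii)] -/
def killedT (t₁ t₂ t₃ : List (List Bool)) (s : ℕ) : Bool :=
  let a := s / 81
  let b := s / 9 % 9
  let c := s % 9
  offLook t₁ (3 * (b % 3) + a % 3) (3 * (a / 3) + b / 3) ||
    offLook t₂ (3 * (2 - c % 3) + (2 - b / 3)) (3 * (b % 3) + c / 3) ||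
      offLook t₃ (3 * (2 - c / 3) + a / 3) (3 * (a % 3) + c % 3)

/-- The same from the profiles. [folklore] -/
def killed (p₁ p₂ p₃ : List (List (ℕ × ℕ) × ℕ)) (s : ℕ) : Bool :=
  killedT (offTab p₁) (offTab p₂) (offTab p₃) s

/-- The number of killed coordinates. [folklore] -/
def killedCount (p₁ p₂ p₃ : List (List (ℕ × ℕ) × ℕ)) : ℕ :=
  ((List.range 729).filter (killed p₁ p₂ p₃)).length

/-- A selected relation: relation `ri` of block `jk` of `S_m` pulled back through slice `sl` of
type `m ∈ {1,2,3}`. [folklore] -/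
structure Sel where
  /-- slicing type -/
  m : ℕ
  /-- slice index (a code `< 9`) -/
  sl : ℕ
  /-- block `3j + k` -/
  jk : ℕ
  /-- relation index -/
  ri : ℕ
  deriving DecidableEq

/-- The triple code of the `idx`-th coordinate of a pulled relation. Type `1`: `((idx,k),(idx,j),c)`;
type `2`: `(a,(rev k, idx),(idx, rev j))`; type `3`: `((k,idx), b, (rev j, idx))`. [folklore] -/
def relCode (m sl jk idx : ℕ) : ℕ :=
  let j := jk / 3
  let k := jk % 3
  if m = 1 then 81 * (3 * idx + k) + 9 * (3 * idx + j) + sl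
  else if m = 2 then 81 * sl + 9 * (3 * (2 - k) + idx) + (3 * idx + (2 - j))
  else 81 * (3 * k + idx) + 9 * sl + (3 * (2 - j) + idx)

/-- The functional of a descriptor. [folklore] -/
def Sel.toFunc (p₁ p₂ p₃ : List (List (ℕ × ℕ) × ℕ)) (q : Sel) : TFunc :=
  let p := if q.m = 1 then p₁ else if q.m = 2 then p₂ else p₃
  let r := (relsOf p q.jk).getD q.ri []
  (List.range 3).map fun idx => (relCode q.m q.sl q.jk idx, r.getD idx 0)

/-- A descriptor is legitimate: an existing relation of an existing block and slice. [folklore] -/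
def Sel.legit (p₁ p₂ p₃ : List (List (ℕ × ℕ) × ℕ)) (q : Sel) : Bool :=
  let p := if q.m = 1 then p₁ else if q.m = 2 then p₂ else p₃
  decide (1 ≤ q.m) && decide (q.m ≤ 3) && decide (q.sl < 9) && decide (q.jk < 9) &&
    decide (q.ri < (relsOf p q.jk).length)

/-! ## Weights -/

/-- Class of an index pair: `φ_p + 3 - φ_q ∈ {0,…,6}` (`φ = (0,1,3)`). [cite: ConnerHarperLandsberg2023, §2.5] -/
def cls (p q : ℕ) : ℕ := phiN p + 3 - phiN q

/-- Weight of the `C`-coordinate code `c = 3j + k`. [cite: ConnerHarperLandsberg2023, §2.5] -/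
def wCN (c : ℕ) : ℕ := (21 - thetaN (c / 3)) + (147 - psiN (c % 3))

/-- Weight of a triple code `81a + 9b + c` (it equals `cls i i' + 7 cls j j' + 49 cls k k'`).
[cite: ConnerHarperLandsberg2023, §2.5] -/
def wT (s : ℕ) : ℕ := wAN (s / 81) + wBN (s / 9 % 9) + wCN (s % 9)

/-- The index pairs of each class. [folklore] -/
def clsPairs (u : ℕ) : List (ℕ × ℕ) :=
  ((List.range 3).flatMap fun p => (List.range 3).map fun q => (p, q)).filter fun pq => cls pq.1 pq.2 = u

/-! ## Generation of the relations of one weight class and the greedy selection (untrusted) -/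

/-- A relation row for the search: descriptor, functional, live support (non-killed codes with
non-zero coefficient). [folklore] -/
def mkRow (p₁ p₂ p₃ : List (List (ℕ × ℕ) × ℕ)) (t₁ t₂ t₃ : List (List Bool)) (q : Sel) :
    Sel × TFunc × List ℕ :=
  let φ := q.toFunc p₁ p₂ p₃
  (q, φ, (φ.filter fun e => e.2 ≠ 0 ∧ !(killedT t₁ t₂ t₃ e.1)).map Prod.fst)

/-- The pulled relations living in the weight class `(u, v, w)`. [folklore] -/
def genRows (p₁ p₂ p₃ : List (List (ℕ × ℕ) × ℕ)) (t₁ t₂ t₃ : List (List Bool))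
    (ctab : List (List (ℕ × ℕ))) (u v w : ℕ) : List (Sel × TFunc × List ℕ) :=
  let PU := ctab.getD u []
  let PV := ctab.getD v []
  let PW := ctab.getD w []
  let r1 := if u = 3 then PV.flatMap fun jj => PW.flatMap fun kk =>
      let jk := 3 * jj.1 + kk.1
      (List.range (relsOf p₁ jk).length).map fun ri => mkRow p₁ p₂ p₃ t₁ t₂ t₃ ⟨1, 3 * jj.2 + kk.2, jk, ri⟩
    else []
  let r2 := if v = 3 then PU.flatMap fun ii => PW.flatMap fun kk =>
      let jk := 3 * (2 - kk.2) + (2 - ii.2)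
      (List.range (relsOf p₂ jk).length).map fun ri => mkRow p₁ p₂ p₃ t₁ t₂ t₃ ⟨2, 3 * ii.1 + kk.1, jk, ri⟩
    else []
  let r3 := if w = 3 then PU.flatMap fun ii => PV.flatMap fun jj =>
      let jk := 3 * (2 - jj.2) + ii.1
      (List.range (relsOf p₃ jk).length).map fun ri => mkRow p₁ p₂ p₃ t₁ t₂ t₃ ⟨3, 3 * ii.2 + jj.1, jk, ri⟩
    else []
  r1 ++ r2 ++ r3

/-- Greedy triangular selection in one weight class (untrusted): repeatedly take a relation with
the fewest admissible live codes, pivot on one of them and forbid the rest. [folklore] -/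
def triSelect : ℕ → List (Sel × TFunc × List ℕ) → List ℕ → List (Sel × ℕ)
  | 0, _, _ => []
  | fuel + 1, rows, forb =>
      let scored := rows.filterMap fun r =>
        match r.2.2.filter fun s => !(forb.contains s) with
        | [] => none
        | s :: rest => some (rest.length, r.1, s, rest)
      match scored with
      | [] => []
      | first :: others =>
          let best := others.foldl (fun acc x => if x.1 < acc.1 then x else acc) first
          let sel := best.2.1
          let s := best.2.2.1
          let rows' := rows.filter fun r => !(r.1 == sel)
          (sel, s) :: triSelect fuel rows' (s :: (best.2.2.2 ++ forb))

/-- **The search**: for each weight class `(u,v,w)` (weight `u + 7v + 49w`) select greedily;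
output the flat list `(weight, descriptor, pivot code)` sorted by weight. [folklore] -/
def triSearch (p₁ p₂ p₃ : List (List (ℕ × ℕ) × ℕ)) : List (ℕ × Sel × ℕ) :=
  let t₁ := offTab p₁
  let t₂ := offTab p₂
  let t₃ := offTab p₃
  let ctab := (List.range 7).map clsPairs
  (List.range 7).flatMap fun w => (List.range 7).flatMap fun v => (List.range 7).flatMap fun u =>
    if u = 3 ∨ v = 3 ∨ w = 3 then
      let rows := genRows p₁ p₂ p₃ t₁ t₂ t₃ ctab u v w
      (triSelect rows.length rows []).map fun q => (u + 7 * v + 49 * w, q.1, q.2)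
    else []

/-! ## The checker -/

/-- Coefficient of a functional at a code (sum over its entries there). [folklore] -/
def TFunc.coef (φ : TFunc) (s : ℕ) : ℤ := ((φ.filter fun e => e.1 = s).map Prod.snd).sum

/-- One entry `(w, sel, c)` is well-formed: `sel` legitimate, all its codes and the pivot `c` are
`< 729` and of weight `w`, the pivot is not a killed coordinate, and the coefficient at the pivot
is non-zero. [folklore] -/
def entryOK (p₁ p₂ p₃ : List (List (ℕ × ℕ) × ℕ)) (e : ℕ × Sel × ℕ) : Bool :=
  let φ := e.2.1.toFunc p₁ p₂ p₃
  e.2.1.legit p₁ p₂ p₃ && decide (e.2.2 < 729) && !(killed p₁ p₂ p₃ e.2.2) && (wT e.2.2 == e.1) &&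
    (φ.all fun x => decide (x.1 < 729) && (wT x.1 == e.1)) && (φ.coef e.2.2 != 0)

/-- Triangularity inside a weight run: the functional vanishes at every later pivot of the SAME
weight, and the next weight is larger. [folklore] -/
def triRun (φ : TFunc) (w : ℕ) : List (ℕ × Sel × ℕ) → Bool
  | [] => true
  | e :: rest => if e.1 = w then (φ.coef e.2.2 == 0) && triRun φ w rest else decide (w < e.1)

/-- Triangularity of the whole flat list. [folklore] -/
def triFlat (p₁ p₂ p₃ : List (List (ℕ × ℕ) × ℕ)) : List (ℕ × Sel × ℕ) → Bool
  | [] => true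
  | e :: rest => triRun (e.2.1.toFunc p₁ p₂ p₃) e.1 rest && triFlat p₁ p₂ p₃ rest

/-- **The checker.** [folklore] -/
def certOK111 (p₁ p₂ p₃ : List (List (ℕ × ℕ) × ℕ)) (cert : List (ℕ × Sel × ℕ)) : Bool :=
  cert.all (entryOK p₁ p₂ p₃) && triFlat p₁ p₂ p₃ cert

/-- **The certified bound on the `(111)`-test dimension** of a triple of profiles:
`729 - #killed - #selected relations` when the checks pass, else `729`.
[cite: ConnerHarperLandsberg2023, §3 (ii)] -/
def bound111 (p₁ p₂ p₃ : List (List (ℕ × ℕ) × ℕ)) : ℕ :=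
  let cert := triSearch p₁ p₂ p₃
  if certOK111 p₁ p₂ p₃ cert then 729 - killedCount p₁ p₂ p₃ - cert.length else 729

end Ker

end MatMul3

end BorderApolarity

end Literature.Computability.AlgebraicComplexity
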